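import Literature.Probability.LatticeModels.RandomClusterMultiCrossing
import Literature.Probability.LatticeModels.RandomClusterRegionToAnnulus
import HarnessLib

/-!
# One crossing of a multi-annulus region costs `c^m`: the one-arm input of the successive conditioning

Topic `Literature/Probability/LatticeModels` (trunk `StatMech`, family `crit-ising`). This file
supplies the hypothesis `hbase` of the generic successive-conditioning bound
`rcMeasure_real_regionArms_le_pow_mul` (`RandomClusterMultiCrossing.lean`) for a finite graph
`G` embedded in `ℤ²` (`ι : V ↪ ℤ²`, edges of `G` are lattice edges), in the geometry of
Duminil-Copin–Smirnov's proof of the tightness of FK interfaces (Clay Math. Proc. 15 (2012),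
Thm. 6.1, eq. (6.1)–(6.2)): a region `U₀ ⊆ E(G)` containing `m` pairwise disjoint concentric
square annuli `x₀ + S_{nᵢ,2nᵢ}` (sup-norm between `nᵢ` and `2nᵢ`), rims `T` avoiding the
annuli, sources `In` inside all annuli and targets `Out` outside all of them.

* `rcMeasure_real_regionCrossing_inter_regionCyl_le` — for every sub-region `U ⊆ U₀` and every
  configuration `η` off `U` with `RegionInsulated B T U η`,
  `φ^B_{G,p,q}(regionCrossing U In Out ∩ {ω ∖ U = η}) ≤ c^m · φ^B_{G,p,q}({ω ∖ U = η})`,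
  where `c` bounds, for each `i`, the probability of an open crossing of the full annulus
  `S_{nᵢ,2nᵢ}` from its inner to its outer boundary under the random-cluster measure of the
  annulus with inner and outer boundary wired together (DCS Lemma 6.3 at `p = p_sd`, `q = 2`:
  `fkIsing_annulusCrossing_le`). Valid for `0 ≤ p < 1`, `q ≥ 1`.

The proof is DCS's "(6.1) uniformly in the configuration outside, hence (6.2)" for ONE arm:
the conditional law of the region given `η` is dominated by the region wired on the vertices it
shares with the outside (`rcMeasure_real_inter_cylinder_le_mul_fromEdgeSet`; by the insulation
invariant these lie on the rims); an open path of `U` from `In` to `Out` contains, for each `i`, a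
path inside the annulus `i` from its inner to its outer square (`exists_walk_in_band`, discrete
intermediate values of the sup-norm); the annuli use disjoint edges, so the probabilities multiply
(`rcMeasure_real_biInter_le_prod`), each factor being the conditional probability of a crossing of
the annulus given everything else — dominated again by the wired measure of the sub-region of the
annulus, wired only over its boundary squares (edges of `U` leaving the annulus force their inner
endpoint onto the boundary), which `rcMeasure_fromEdgeSet_real_crossing_le_annulus`
(`RandomClusterRegionToAnnulus.lean`) bounds by the crossing probability of the full wired annulus.

## References

* H. Duminil-Copin, S. Smirnov, *Conformal invariance of lattice models*, Clay Math. Proc. 15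
  (2012), §6.1, proof of Thm. 6.1, eq. (6.1)–(6.2), Lemma 6.3. [DuminilCopinSmirnov2012Clay]
* G. Grimmett, *The Random-Cluster Model*, Springer (2006), Lemma (4.13), Lemma (4.14).
  [Grimmett2006]
-/

noncomputable section

namespace Literature.Probability.LatticeModels

open Finset SimpleGraph _root_.MeasureTheory Literature.Probability.Percolation

/-! ### The sup-norm level around a centre, and walks confined to a band of levels -/

section Levels

/-- The sup-norm distance of a lattice site to the centre `x₀`: `‖z - x₀‖_∞ = max |z₀-x₀₀| |z₁-x₀₁|`.
(DCS 2012, §6.1, the square annuli `S_{r,R}(x)`.) [cite: DuminilCopinSmirnov2012Clay, §6.1] -/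
def supLevel (x₀ z : Site 2) : ℤ := max |(z - x₀) 0| |(z - x₀) 1|

/-- The sup-norm level is `1`-Lipschitz along lattice edges. [folklore] -/
theorem supLevel_le_of_adj (x₀ : Site 2) {z w : Site 2} (h : (zdGraph 2).Adj z w) :
    supLevel x₀ z ≤ supLevel x₀ w + 1 := by
  have h' : (zdGraph 2).Adj (z - x₀) (w - x₀) := (zdGraph_adj_sub_iff z w x₀).2 h
  have h0 := abs_le.1 (abs_sub_le_one_of_zdGraph_two_adj h' 0)
  have h1 := abs_le.1 (abs_sub_le_one_of_zdGraph_two_adj h' 1)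
  unfold supLevel
  have a0 := abs_le.1 (le_max_left |(w - x₀) 0| |(w - x₀) 1|)
  have a1 := abs_le.1 (le_max_right |(w - x₀) 0| |(w - x₀) 1|)
  refine max_le ?_ ?_ <;> rw [abs_le] <;> constructor <;> omega

/-- Membership in the annulus `x₀ + S_{n,2n}` in terms of the level. [folklore] -/
theorem sub_mem_squareAnnulusSites_iff {x₀ z : Site 2} {n : ℕ} :
    z - x₀ ∈ squareAnnulusSites n ↔ (n : ℤ) ≤ supLevel x₀ z ∧ supLevel x₀ z ≤ 2 * n := by
  rw [mem_squareAnnulusSites_iff]; rfl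

variable {V : Type*}

/-- **A walk across a band of levels contains a walk inside the band.** Let `ℓ` change by at most
one along the edges of `H` (in both directions) and let a walk of `H` run from a vertex of level
`< a` to a vertex of level `> b`, `a ≤ b`. Then some vertex of level exactly `a` is joined to some
vertex of level exactly `b` by a walk of `H` all of whose vertices have level in `[a, b]` (enter
the band at the last visit of level `a` before the first visit of level `b`).
(Kesten 1982, §2.2, first/last intersections; the step "an open path from the inner to the
outer boundary of each annulus" of DCS 2012, proof of Thm. 6.1.) [folklore] -/
theorem exists_walk_in_band {H : SimpleGraph V} (ℓ : V → ℤ)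
    (hH : ∀ ⦃u v : V⦄, H.Adj u v → ℓ u ≤ ℓ v + 1) {a b : ℤ} (hab : a ≤ b) {x y : V}
    (hx : ℓ x ≤ a) (hy : b ≤ ℓ y) (hxy : H.Reachable x y) :
    ∃ u v : V, ℓ u = a ∧ ℓ v = b ∧
      (SimpleGraph.fromRel fun s t ↦ H.Adj s t ∧ a ≤ ℓ s ∧ ℓ s ≤ b ∧ a ≤ ℓ t ∧ ℓ t ≤ b).Reachable u v := by
  classical
  obtain ⟨w⟩ := hxy.symm
  -- from `y` down to the first vertex of level `a`: all levels `≥ a`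
  obtain ⟨u, w₁, hu, hsupp₁⟩ := exists_walk_to_level ℓ hH w (hab.trans hy) hx
  -- transfer to the graph of edges between vertices of level `≥ a`
  set H₁ : SimpleGraph V := SimpleGraph.fromRel fun s t ↦ H.Adj s t ∧ a ≤ ℓ s ∧ a ≤ ℓ t with hH₁
  have hw₁ : ∀ e, e ∈ w₁.edges → e ∈ H₁.edgeSet := by
    intro e he
    induction e using Sym2.ind with
    | h s t =>
      rw [mem_edgeSet, hH₁, fromRel_adj]
      have hadj : H.Adj s t := w₁.adj_of_mem_edges he
      exact ⟨hadj.ne, Or.inl ⟨hadj, hsupp₁ s (w₁.fst_mem_support_of_mem_edges he),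
        hsupp₁ t (w₁.snd_mem_support_of_mem_edges he)⟩⟩
  set w₁' : H₁.Walk y u := w₁.transfer H₁ hw₁ with hw₁'
  -- from `u` up to the first vertex of level `b`, inside `H₁`: all levels `≤ b`
  have hH₁lip : ∀ ⦃s t : V⦄, H₁.Adj s t → -ℓ s ≤ -ℓ t + 1 := by
    intro s t hst
    rw [hH₁, fromRel_adj] at hst
    rcases hst.2 with h | h
    · have := hH h.1.symm; omega
    · have := hH h.1; omega
  obtain ⟨v, w₂, hv, hsupp₂⟩ := exists_walk_to_level (fun z ↦ -ℓ z) hH₁lip w₁'.reverse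
    (a := -b) (by rw [hu]; omega) (by omega)
  refine ⟨u, v, hu, by omega, ?_⟩
  -- every vertex of `w₂` has level in `[a, b]`: a walk of `H₁` from a vertex of level `≥ a` stays at levels `≥ a`
  have key : ∀ {s t : V} (w' : H₁.Walk s t), a ≤ ℓ s → ∀ z ∈ w'.support, a ≤ ℓ z := by
    intro s t w'
    induction w' with
    | nil => intro hs z hz; rw [SimpleGraph.Walk.support_nil, List.mem_singleton] at hz; rwa [hz]
    | cons h' _ ih =>
      intro hs z hz
      rw [SimpleGraph.Walk.support_cons, List.mem_cons] at hz
      rcases hz with rfl | hz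
      · exact hs
      · refine ih ?_ z hz
        rw [hH₁, fromRel_adj] at h'
        rcases h'.2 with h'' | h''
        · exact h''.2.2
        · exact h''.2.1
  have hlev : ∀ z ∈ w₂.support, a ≤ ℓ z ∧ ℓ z ≤ b := fun z hz ↦
    ⟨key w₂ (by rw [hu]) z hz, by have := hsupp₂ z hz; omega⟩
  -- transfer `w₂` to the band graph
  refine ⟨w₂.transfer _ fun e he ↦ ?_⟩
  induction e using Sym2.ind with
  | h s t =>
    rw [mem_edgeSet, fromRel_adj]
    have hadj : H₁.Adj s t := w₂.adj_of_mem_edges he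
    have hs := hlev s (w₂.fst_mem_support_of_mem_edges he)
    have ht := hlev t (w₂.snd_mem_support_of_mem_edges he)
    rw [hH₁, fromRel_adj] at hadj
    refine ⟨hadj.1, ?_⟩
    rcases hadj.2 with h | h
    · exact Or.inl ⟨h.1, hs.1, hs.2, ht.1, ht.2⟩
    · exact Or.inr ⟨h.1, ht.1, ht.2, hs.1, hs.2⟩

end Levels

/-! ### Edge sets of `fromEdgeSet`, with the instance taken from the context -/

section FromEdgeSet

variable {V : Type*}

/-- An element of the edge set of `fromEdgeSet F` lies in `F` (the `Fintype` instance is an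
implicit argument, so that it is taken from the hypothesis). [folklore] -/
theorem mem_finset_of_mem_edgeFinset_fromEdgeSet {F : Finset (Sym2 V)}
    {inst : Fintype (fromEdgeSet (F : Set (Sym2 V))).edgeSet} {e : Sym2 V}
    (h : e ∈ @edgeFinset V (fromEdgeSet (F : Set (Sym2 V))) inst) : e ∈ F := by
  rw [mem_edgeFinset, edgeSet_fromEdgeSet] at h
  exact h.1

/-- A non-diagonal element of `F` lies in the edge set of `fromEdgeSet F` (instance from the
goal). [folklore] -/
theorem mem_edgeFinset_fromEdgeSet_of_mem {F : Finset (Sym2 V)}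
    {inst : Fintype (fromEdgeSet (F : Set (Sym2 V))).edgeSet} {e : Sym2 V} (he : e ∈ F) (hnd : ¬ e.IsDiag) :
    e ∈ @edgeFinset V (fromEdgeSet (F : Set (Sym2 V))) inst := by
  rw [mem_edgeFinset, edgeSet_fromEdgeSet]
  exact ⟨he, hnd⟩

end FromEdgeSet

/-! ### Evaluating events only on the edge sets of the graph -/

section Support

variable {V : Type*} [Fintype V] [DecidableEq V] (G : SimpleGraph V) [DecidableRel G.Adj]

/-- **Events are compared on the edge sets of the graph only**: if `A ⊆ A'` on the configurations
`ω ⊆ E(G)`, then `φ^B_{G,p,q}(A) ≤ φ^B_{G,p,q}(A')`. [cite: Grimmett2006, §1.2, eq. (1.2)] -/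
theorem rcMeasure_real_mono_on_edgeFinset {p q : ℝ} (hp : p ∈ Set.Icc (0 : ℝ) 1) (hq : 0 < q) (B : Set V)
    {A A' : Set (Percolation.BondConfig V)}
    (h : ∀ ω : Finset (Sym2 V), ω ⊆ G.edgeFinset → (↑ω : Percolation.BondConfig V) ∈ A →
      (↑ω : Percolation.BondConfig V) ∈ A') :
    (rcMeasure G p q B).real A ≤ (rcMeasure G p q B).real A' := by
  rw [rcMeasure_real_eq_sum_indicator G hp hq B A, rcMeasure_real_eq_sum_indicator G hp hq B A']
  exact sum_indicator_mul_rcWeight_le G hp hq B fun ω hω ↦ h ω (Finset.mem_powerset.1 hω)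

end Support

/-! ### The one-arm bound for a multi-annulus region -/

section OneArm

variable {V : Type*} [Fintype V] [DecidableEq V] (G : SimpleGraph V) [DecidableRel G.Adj]
  (ι : V ↪ Site 2) (x₀ : Site 2)

/-- The edges of a region lying in the annulus `x₀ + S_{n,2n}` (both endpoints at level in
`[n, 2n]`). [cite: DuminilCopinSmirnov2012Clay, §6.1] -/
def annulusEdges (U : Finset (Sym2 V)) (n : ℕ) : Finset (Sym2 V) :=
  U.filter fun e ↦ ∀ v ∈ e, (n : ℤ) ≤ supLevel x₀ (ι v) ∧ supLevel x₀ (ι v) ≤ 2 * n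

/-- Membership in `annulusEdges`. [folklore] -/
theorem mem_annulusEdges {U : Finset (Sym2 V)} {n : ℕ} {e : Sym2 V} :
    e ∈ annulusEdges ι x₀ U n ↔ e ∈ U ∧ ∀ v ∈ e, (n : ℤ) ≤ supLevel x₀ (ι v) ∧ supLevel x₀ (ι v) ≤ 2 * n := by
  rw [annulusEdges, Finset.mem_filter]

open scoped Classical in
/-- The vertices at level exactly `k` around `x₀`. [folklore] -/
def supLevelSet (k : ℤ) : Finset V := Finset.univ.filter fun v ↦ supLevel x₀ (ι v) = k

omit [DecidableEq V] in
/-- Membership in `supLevelSet`. [folklore] -/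
theorem mem_supLevelSet {k : ℤ} {v : V} : v ∈ supLevelSet ι x₀ k ↔ supLevel x₀ (ι v) = k := by
  classical
  rw [supLevelSet, Finset.mem_filter]
  simp only [Finset.mem_univ, true_and]

/-- **An open path of a region from inside to outside an annulus crosses the annulus inside the
annulus**: if `ω ∈ regionCrossing U In Out` with `In` at levels `< n`, `Out` at levels `> 2n`,
and the edges of `U` are lattice edges under `ι`, then
`ω ∈ regionCrossing (annulusEdges U n) (supLevelSet n) (supLevelSet 2n)`.
[cite: DuminilCopinSmirnov2012Clay, §6.1, proof of Thm. 6.1] -/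
theorem regionCrossing_annulusEdges_of_regionCrossing {U : Finset (Sym2 V)}
    (hUlat : ∀ u v : V, s(u, v) ∈ U → (zdGraph 2).Adj (ι u) (ι v)) {n : ℕ} (hn : 1 ≤ n)
    {In Out : Finset V} (hIn : ∀ a ∈ In, supLevel x₀ (ι a) < n) (hOut : ∀ b ∈ Out, 2 * (n : ℤ) < supLevel x₀ (ι b))
    {ω : Percolation.BondConfig V} (hω : ω ∈ regionCrossing U In Out) :
    ω ∈ regionCrossing (annulusEdges ι x₀ U n) (supLevelSet ι x₀ n) (supLevelSet ι x₀ (2 * n)) := by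
  obtain ⟨a, ha, b, hb, hab⟩ := hω
  have hlip : ∀ ⦃u v : V⦄, (regionGraph U ω).Adj u v → supLevel x₀ (ι u) ≤ supLevel x₀ (ι v) + 1 := by
    intro u v huv
    exact supLevel_le_of_adj x₀ (hUlat u v (regionGraph_adj.1 huv).2.1)
  obtain ⟨u, v, hu, hv, huv⟩ := exists_walk_in_band (fun z ↦ supLevel x₀ (ι z)) hlip
    (a := n) (b := 2 * n) (by omega) (hIn a ha).le (hOut b hb).le hab
  refine ⟨u, (mem_supLevelSet ι x₀).2 hu, v, (mem_supLevelSet ι x₀).2 (by exact_mod_cast hv), huv.mono ?_⟩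
  intro s t hst
  rw [fromRel_adj] at hst
  obtain ⟨-, h | h⟩ := hst
  · obtain ⟨hadj, hs1, hs2, ht1, ht2⟩ := h
    have hadj' := regionGraph_adj.1 hadj
    refine regionGraph_adj.2 ⟨hadj'.1, (mem_annulusEdges ι x₀).2 ⟨hadj'.2.1, fun z hz ↦ ?_⟩, hadj'.2.2⟩
    rcases Sym2.mem_iff.1 hz with rfl | rfl
    · exact ⟨hs1, by exact_mod_cast hs2⟩
    · exact ⟨ht1, by exact_mod_cast ht2⟩
  · obtain ⟨hadj, ht1, ht2, hs1, hs2⟩ := h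
    have hadj' := regionGraph_adj.1 hadj.symm
    refine regionGraph_adj.2 ⟨hadj'.1, (mem_annulusEdges ι x₀).2 ⟨hadj'.2.1, fun z hz ↦ ?_⟩, hadj'.2.2⟩
    rcases Sym2.mem_iff.1 hz with rfl | rfl
    · exact ⟨hs1, by exact_mod_cast hs2⟩
    · exact ⟨ht1, by exact_mod_cast ht2⟩

/-- **One crossing of a multi-annulus region costs `c^m`, uniformly in an insulated outside
configuration** (Duminil-Copin–Smirnov 2012, proof of Thm. 6.1: eq. (6.1) for one arm, "uniformly
in the configuration outside the annulus", multiplied over `m` disjoint annuli as in (6.2)). Let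
`G` be a finite graph whose edges are lattice edges under `ι : V ↪ ℤ²`, `U₀ ⊆ E(G)` a region,
`x₀ + S_{nᵢ,2nᵢ}` (`i < m`, `nᵢ ≥ 1`) pairwise disjoint annuli whose lattice sites contain no
rim vertex of `T`, `In` vertices at levels `< nᵢ` and `Out` vertices at levels `> 2nᵢ` for all
`i`, and let `c ≥ 0` bound, for every `i`, the probability of an open inner-to-outer crossing of
the full annulus `S_{nᵢ,2nᵢ}` under its random-cluster measure with inner and outer boundary wired
together. Then for `0 ≤ p < 1`, `q ≥ 1`, every sub-region `U ⊆ U₀` and every outside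
configuration `η` with `RegionInsulated B T U η` (no further hypothesis on `η` is needed):
`φ^B_{G,p,q}(regionCrossing U In Out ∩ {ω ∖ U = η}) ≤ c^m φ^B_{G,p,q}({ω ∖ U = η})`.
This is the hypothesis `hbase` of `rcMeasure_real_regionArms_le_pow_mul` with `θ = c^m`.
[cite: DuminilCopinSmirnov2012Clay, Thm. 6.1 (proof, eq. (6.1)–(6.2)) and Lemma 6.3] -/
theorem rcMeasure_real_regionCrossing_inter_regionCyl_le {p q : ℝ} (hp : p ∈ Set.Icc (0 : ℝ) 1)
    (hp1 : p < 1) (hq : 1 ≤ q) (B T : Set V)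
    (hGlat : ∀ u v : V, G.Adj u v → (zdGraph 2).Adj (ι u) (ι v))
    (U₀ : Finset (Sym2 V)) (hU₀ : U₀ ⊆ G.edgeFinset)
    {m : ℕ} (ns : Fin m → ℕ) (hns : ∀ i, 1 ≤ ns i)
    (hdisj : ∀ i j, i ≠ j → ∀ z : Site 2, (ns i : ℤ) ≤ supLevel x₀ z → supLevel x₀ z ≤ 2 * ns i →
      ¬ ((ns j : ℤ) ≤ supLevel x₀ z ∧ supLevel x₀ z ≤ 2 * ns j))
    (hT : ∀ v ∈ T, ∀ i, ¬ ((ns i : ℤ) ≤ supLevel x₀ (ι v) ∧ supLevel x₀ (ι v) ≤ 2 * ns i))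
    (In Out : Finset V) (hIn : ∀ a ∈ In, ∀ i, supLevel x₀ (ι a) < ns i)
    (hOut : ∀ b ∈ Out, ∀ i, 2 * (ns i : ℤ) < supLevel x₀ (ι b))
    {c : ℝ} (hc : 0 ≤ c)
    (hann : ∀ i, (rcMeasure (finsetGraph (zdGraph 2) (squareAnnulusSites (ns i))) p q
        (squareAnnulusInner (ns i) ∪ squareAnnulusOuter (ns i))).real
        (openCrossing Set.univ (squareAnnulusInner (ns i)) (squareAnnulusOuter (ns i))) ≤ c)
    (U : Finset (Sym2 V)) (hU : U ⊆ U₀) (η : Finset (Sym2 V)) (hins : RegionInsulated B T U η) :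
    (rcMeasure G p q B).real (regionCrossing U In Out ∩ regionCyl U η) ≤
      c ^ m * (rcMeasure G p q B).real (regionCyl U η) := by
  classical
  have hq0 : 0 < q := one_pos.trans_le hq
  have hUE : U ⊆ G.edgeFinset := hU.trans hU₀
  have hUlat : ∀ u v : V, s(u, v) ∈ U → (zdGraph 2).Adj (ι u) (ι v) :=
    fun u v h ↦ hGlat u v (mem_edgeFinset.1 (hUE h))
  -- **Step 1**: the conditional law of the region is dominated by the region wired on `W`
  set Inc : Set V := {v | ∃ e ∈ U, v ∈ e} with hInc
  set W : Set V := {v | v ∈ Inc → v ∈ T} with hW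
  have hBW : B ⊆ W := fun v hvB ⟨e, he, hve⟩ ↦ hins e he v hve (Or.inl hvB)
  have hηW : ∀ e ∈ (↑η : Set (Sym2 V)), ∀ x ∈ e, x ∈ W :=
    fun e' he' x hxe' ⟨e, he, hxe⟩ ↦ hins e he x hxe (Or.inr ⟨e', he', hxe'⟩)
  set ψ := rcMeasure (fromEdgeSet (U : Set (Sym2 V))) p q W with hψ
  have hdet : {ω : Percolation.BondConfig V | ω ∩ ↑U ∈ regionCrossing U In Out} = regionCrossing U In Out := by
    ext ω
    simp only [Set.mem_setOf_eq]
    have : regionGraph U (ω ∩ ↑U) = regionGraph U ω := regionGraph_eq_of_inter_eq (by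
      rw [Set.inter_assoc, Set.inter_self])
    simp only [regionCrossing, Set.mem_setOf_eq, this]
  have step1 : (rcMeasure G p q B).real (regionCrossing U In Out ∩ regionCyl U η) ≤
      (rcMeasure G p q B).real (regionCyl U η) * ψ.real (regionCrossing U In Out) := by
    have := rcMeasure_real_inter_cylinder_le_mul_fromEdgeSet G hp hq B U hUE (↑η) hBW hηW
      (isUpperSet_regionCrossing U In Out)
    rwa [hdet] at this
  -- **Step 2**: under `ψ`, a crossing of the region crosses every annulus inside the annulus
  set Uann : Fin m → Finset (Sym2 V) := fun i ↦ annulusEdges ι x₀ U (ns i) with hUann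
  set Cr : Fin m → Set (Percolation.BondConfig V) := fun i ↦
    regionCrossing (Uann i) (supLevelSet ι x₀ (ns i)) (supLevelSet ι x₀ (2 * ns i)) with hCr
  have step2 : ψ.real (regionCrossing U In Out) ≤ ψ.real (⋂ i ∈ (Finset.univ : Finset (Fin m)), Cr i) := by
    haveI := isProbabilityMeasure_rcMeasure (fromEdgeSet (U : Set (Sym2 V))) hp hq0 W
    refine measureReal_mono fun ω hω ↦ ?_
    simp only [Set.mem_iInter, Finset.mem_univ, forall_true_left]
    intro i
    exact regionCrossing_annulusEdges_of_regionCrossing ι x₀ hUlat (hns i) (fun a ha ↦ hIn a ha i)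
      (fun b hb ↦ hOut b hb i) hω
  -- **Step 3**: the annuli use disjoint edges, so the crossing probabilities multiply
  have hUdisj : ((Finset.univ : Finset (Fin m)) : Set (Fin m)).Pairwise fun i j ↦ Disjoint (Uann i) (Uann j) := by
    intro i _ j _ hij
    rw [Finset.disjoint_left]
    intro e hei hej
    obtain ⟨heU, hi⟩ := (mem_annulusEdges ι x₀).1 hei
    obtain ⟨-, hj⟩ := (mem_annulusEdges ι x₀).1 hej
    induction e using Sym2.ind with
    | h u v =>
      have hiu := hi u (Sym2.mem_mk_left u v)
      have hju := hj u (Sym2.mem_mk_left u v)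
      exact hdisj i j hij (ι u) hiu.1 hiu.2 hju
  have hCrdet : ∀ i ∈ (Finset.univ : Finset (Fin m)), ∀ ω₁ ω₂ : Percolation.BondConfig V,
      ω₁ ∩ ↑(Uann i) = ω₂ ∩ ↑(Uann i) → (ω₁ ∈ Cr i ↔ ω₂ ∈ Cr i) := by
    intro i _ ω₁ ω₂ h
    simp only [hCr, regionCrossing, Set.mem_setOf_eq, regionGraph_eq_of_inter_eq h]
  -- the one-annulus conditional bound under `ψ`, multiplied over the annuli
  have step3 : ψ.real (⋂ i ∈ (Finset.univ : Finset (Fin m)), Cr i) ≤ ∏ i ∈ (Finset.univ : Finset (Fin m)), c := by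
    refine rcMeasure_real_biInter_le_prod (fromEdgeSet (U : Set (Sym2 V))) hp hq0 W Finset.univ Uann hUdisj Cr
      hCrdet (fun _ ↦ c) (fun _ _ ↦ hc) fun i _ ξ hξ ↦ ?_
    set n := ns i with hn
    have hn1 : 1 ≤ n := hns i
    -- edges of `ξ` are edges of `U` off the annulus
    have hξU : ∀ e ∈ ξ, e ∈ U ∧ e ∉ Uann i := by
      intro e he
      obtain ⟨he1, he2⟩ := Finset.mem_sdiff.1 (hξ he)
      exact ⟨mem_finset_of_mem_edgeFinset_fromEdgeSet he1, he2⟩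
    have hUannU : Uann i ⊆ U := Finset.filter_subset _ _
    -- the wired set of the annulus region: vertices of its edges lying on the boundary squares
    set Wi : Set V := {v | (∃ e ∈ Uann i, v ∈ e) → supLevel x₀ (ι v) = n ∨ supLevel x₀ (ι v) = 2 * n}
      with hWi
    -- `W ⊆ Wi`: a vertex of `W` meeting an edge of the annulus is a rim vertex — impossible
    have hWWi : W ⊆ Wi := by
      rintro v hvW ⟨e, he, hve⟩
      exfalso
      have hvInc : v ∈ Inc := ⟨e, hUannU he, hve⟩
      have hvT : v ∈ T := hvW hvInc
      obtain ⟨-, hlev⟩ := (mem_annulusEdges ι x₀).1 he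
      exact hT v hvT i (hlev v hve)
    -- endpoints of `ξ`-edges meeting the annulus lie on its boundary squares
    have hξWi : ∀ e ∈ (↑ξ : Set (Sym2 V)), ∀ x ∈ e, x ∈ Wi := by
      rintro e he x hxe ⟨e', he', hxe'⟩
      obtain ⟨heU, henot⟩ := hξU e he
      obtain ⟨-, hlev'⟩ := (mem_annulusEdges ι x₀).1 he'
      obtain ⟨hx1, hx2⟩ := hlev' x hxe'
      -- the other endpoint of `e` is off the annulus
      induction e using Sym2.ind with
      | h u w =>
        have hnot : ¬ ∀ v ∈ s(u, w), (n : ℤ) ≤ supLevel x₀ (ι v) ∧ supLevel x₀ (ι v) ≤ 2 * n :=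
          fun hall ↦ henot ((mem_annulusEdges ι x₀).2 ⟨heU, hall⟩)
        have hadj := supLevel_le_of_adj x₀ (hUlat u w heU)
        have hadj' := supLevel_le_of_adj x₀ (hUlat u w heU).symm
        rcases Sym2.mem_iff.1 hxe with rfl | rfl
        · -- `x = u`; then `w` is off the annulus
          have hw : ¬ ((n : ℤ) ≤ supLevel x₀ (ι w) ∧ supLevel x₀ (ι w) ≤ 2 * n) := by
            intro hw
            exact hnot fun v hv ↦ by
              rcases Sym2.mem_iff.1 hv with rfl | rfl
              · exact ⟨hx1, hx2⟩
              · exact hw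
          change supLevel x₀ (ι x) = n ∨ supLevel x₀ (ι x) = 2 * n
          omega
        · have hu : ¬ ((n : ℤ) ≤ supLevel x₀ (ι u) ∧ supLevel x₀ (ι u) ≤ 2 * n) := by
            intro hu
            exact hnot fun v hv ↦ by
              rcases Sym2.mem_iff.1 hv with rfl | rfl
              · exact hu
              · exact ⟨hx1, hx2⟩
          change supLevel x₀ (ι x) = n ∨ supLevel x₀ (ι x) = 2 * n
          omega
    -- the crossing of the annulus only depends on the annulus edges
    have hCrdet' : {ω : Percolation.BondConfig V | ω ∩ ↑(Uann i) ∈ Cr i} = Cr i := by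
      ext ω
      exact hCrdet i (Finset.mem_univ _) _ _ (by rw [Set.inter_assoc, Set.inter_self])
    have hCrup : IsUpperSet (Cr i) := isUpperSet_regionCrossing _ _ _
    have h1 := rcMeasure_real_inter_cylinder_le_mul_fromEdgeSet (fromEdgeSet (U : Set (Sym2 V))) hp hq W
      (Uann i) (fun e he ↦ mem_edgeFinset_fromEdgeSet_of_mem (hUannU he) fun hd ↦
        G.not_isDiag_of_mem_edgeSet (mem_edgeFinset.1 (hUE (hUannU he))) hd) (↑ξ) hWWi hξWi hCrup
    rw [hCrdet'] at h1
    refine h1.trans ?_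
    rw [mul_comm]
    refine mul_le_mul_of_nonneg_right ?_ measureReal_nonneg
    -- **Step 4**: the wired annulus region versus the full wired annulus
    have h2 : (rcMeasure (fromEdgeSet (↑(Uann i) : Set (Sym2 V))) p q Wi).real (Cr i) ≤
        (rcMeasure (fromEdgeSet (↑(Uann i) : Set (Sym2 V))) p q Wi).real
          {ω | ∃ a ∈ (↑(supLevelSet ι x₀ n) : Set V), ∃ b ∈ (↑(supLevelSet ι x₀ (2 * n)) : Set V),
            (openGraph ω).Reachable a b} := by
      haveI := isProbabilityMeasure_rcMeasure (fromEdgeSet (↑(Uann i) : Set (Sym2 V))) hp hq0 Wi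
      refine measureReal_mono ?_
      rintro ω ⟨a, ha, b, hb, hab⟩
      refine ⟨a, ha, b, ?_, hab.mono fun s t hst ↦ ?_⟩
      · exact_mod_cast hb
      · rw [openGraph_adj]; exact ⟨(regionGraph_adj.1 hst).1, (regionGraph_adj.1 hst).2.2⟩
    refine h2.trans ((rcMeasure_fromEdgeSet_real_crossing_le_annulus ι x₀ n hp hp1 hq (Uann i)
      (fun u v h ↦ hUlat u v (hUannU h)) (fun e he v hv ↦ ?_) Wi (fun e he v hv hvW ↦ ?_)
      _ _ (fun a ha ↦ ?_) (fun b hb ↦ ?_)).trans (hann i))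
    · exact sub_mem_squareAnnulusSites_iff.2 (((mem_annulusEdges ι x₀).1 he).2 v hv)
    · exact hvW ⟨e, he, hv⟩
    · exact (mem_supLevelSet ι x₀).1 ha
    · have := (mem_supLevelSet ι x₀).1 (Finset.mem_coe.1 hb)
      change max |(ι b - x₀) 0| |(ι b - x₀) 1| = 2 * (n : ℤ)
      exact this
  rw [Finset.prod_const, Finset.card_univ, Fintype.card_fin] at step3
  -- assemble
  calc (rcMeasure G p q B).real (regionCrossing U In Out ∩ regionCyl U η)
      ≤ (rcMeasure G p q B).real (regionCyl U η) * ψ.real (regionCrossing U In Out) := step1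
    _ ≤ (rcMeasure G p q B).real (regionCyl U η) * c ^ m :=
        mul_le_mul_of_nonneg_left (step2.trans step3) measureReal_nonneg
    _ = c ^ m * (rcMeasure G p q B).real (regionCyl U η) := mul_comm _ _

end OneArm

end Literature.Probability.LatticeModels

end
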